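import Summits.AtomisticToContinuum.HydrodynamicLimit.Theorems.TwoClocksEquilibriumFastWindowLDBirthT12Angular
import Literature.MathematicalPhysics.KineticTheory.LinearLorentzBoltzmannDuality
import Literature.Analysis.FluidPDE.SphereIntegral
import HarnessLib

/-!
# Sphere calculus on `S² ⊆ ℝ³` for the K2R refutation line — preparatory lemmas

Route `EnskogAdjointDuality` of `AtomisticToContinuum/HydrodynamicLimit`, crux K2R
(`AdjointEnskogTestFamilyR`, stmt-AtomisticToContinuum-11592), line `refutation`, stub
`stub_sphereCalculus` (file 1 of 3: generic sphere / polar-coordinate lemmas; keyed sub-goal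
`stub_sphereCalculus_prep`).

* Symmetry: a `σ`-integral vanishes as soon as the integrand is odd under ONE linear isometry
  (`k2r_ref_integral_sphere_eq_zero_of_isometry`), in particular under the flip of one coordinate
  (`k2r_ref_integral_sphere_eq_zero_of_flip`).
* The degree-one Funk–Hecke formula `∫ g(⟪a,ν⟫) ν dσ = (2π ∫_{-1}^{1} t g(t) dt) a`
  (`k2r_ref_funkHecke_one`): the reflection fixing `a` kills the part orthogonal to `a`, the
  `a`-component is Archimedes' hat-box law (`integral_sphere_comp_inner_real`).
* Hat-box constants along the first coordinate axis: `∫ ν₀² dσ = 4π/3`, `∫ (ν₀)₊³ dσ = π/2`,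
  `∫ (ν₀)₊⁴ dσ = 2π/5`.
* Polar coordinates in `ℝ³` (`sphereMeasure = volume.toSphere`): the radial formula
  `∫ f(|v|) dv = 4π ∫₀^∞ r² f(r) dr` with its integrability transfer, and the separated formula
  `∫ f = (∫_{S²} Y dσ) · ∫₀^∞ r² φ(r) dr` when `f(rω) = φ(r) Y(ω)`.

References: Funk–Hecke in degree one and Archimedes' hat-box theorem [folklore].
-/

noncomputable section

open MeasureTheory Real Set Filter Metric
open scoped InnerProductSpace ENNReal

namespace Summit.AtomisticToContinuum.HydrodynamicLimit.Theorems.EnskogAdjointDuality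

open Literature.Analysis.FluidPDE Literature.MathematicalPhysics.KineticTheory
open Summit.AtomisticToContinuum.HydrodynamicLimit.Theorems.ClampedCorrectorBirth

/-! ### Symmetries of the surface measure -/

/-- If `F` is odd under the sphere map induced by a linear isometry `A` (`F (A ω) = -F ω`) then
`∫ F dσ = 0` (`σ` is `A`-invariant; no integrability needed). [folklore] -/
theorem k2r_ref_integral_sphere_eq_zero_of_isometry {G : Type*} [NormedAddCommGroup G]
    [NormedSpace ℝ G] (A : EuclideanSpace ℝ (Fin 3) ≃ₗᵢ[ℝ] EuclideanSpace ℝ (Fin 3)) {F : sphere (0 : EuclideanSpace ℝ (Fin 3)) 1 → G}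
    (hF : ∀ ω, F ((mapsTo_sphere_linearIsometryEquiv A).restrict _ _ _ ω) = -F ω) :
    ∫ ω, F ω ∂(sphereMeasure : Measure (sphere (0 : EuclideanSpace ℝ (Fin 3)) 1)) = 0 := by
  have h := integral_sphere_comp_isometry A F
  simp_rw [hF, integral_neg] at h
  have h2 : (2 : ℝ) • ∫ ω, F ω ∂(sphereMeasure : Measure (sphere (0 : EuclideanSpace ℝ (Fin 3)) 1)) = 0 := by
    rw [two_smul]
    nth_rewrite 1 [← h]
    exact neg_add_cancel _
  exact (smul_eq_zero.1 h2).resolve_left two_ne_zero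

/-- Coordinates of a point of `S²` lie in `[-1, 1]`. [folklore] -/
theorem k2r_ref_coord_mem_Icc (ω : sphere (0 : EuclideanSpace ℝ (Fin 3)) 1) (i : Fin 3) : (ω : EuclideanSpace ℝ (Fin 3)) i ∈ Icc (-1 : ℝ) 1 := by
  have h : |(ω : EuclideanSpace ℝ (Fin 3)) i| ≤ 1 := by
    have := PiLp.norm_apply_le (ω : EuclideanSpace ℝ (Fin 3)) i
    rw [norm_eq_of_mem_sphere ω] at this
    simpa using this
  exact ⟨(abs_le.1 h).1, (abs_le.1 h).2⟩

/-- **Flip of one coordinate.** If `F : S² → G` changes sign whenever the `j`-th coordinate is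
negated and the others are kept, then `∫ F dσ = 0` (the reflection in the hyperplane `e_j^⊥` is a
linear isometry preserving `σ`). [folklore] -/
theorem k2r_ref_integral_sphere_eq_zero_of_flip {G : Type*} [NormedAddCommGroup G]
    [NormedSpace ℝ G] (j : Fin 3) {F : sphere (0 : EuclideanSpace ℝ (Fin 3)) 1 → G}
    (hF : ∀ ω ω' : sphere (0 : EuclideanSpace ℝ (Fin 3)) 1, (ω' : EuclideanSpace ℝ (Fin 3)) j = -(ω : EuclideanSpace ℝ (Fin 3)) j → (∀ i, i ≠ j → (ω' : EuclideanSpace ℝ (Fin 3)) i = (ω : EuclideanSpace ℝ (Fin 3)) i) →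
      F ω' = -F ω) :
    ∫ ω, F ω ∂(sphereMeasure : Measure (sphere (0 : EuclideanSpace ℝ (Fin 3)) 1)) = 0 := by
  set e : sphere (0 : EuclideanSpace ℝ (Fin 3)) 1 := ⟨EuclideanSpace.single j (1 : ℝ), by simp⟩ with he
  have hR : ∀ v : EuclideanSpace ℝ (Fin 3), (ℝ ∙ (e : EuclideanSpace ℝ (Fin 3)))ᗮ.reflection v =
      v - (2 * ⟪v, (e : EuclideanSpace ℝ (Fin 3))⟫_ℝ) • (e : EuclideanSpace ℝ (Fin 3)) := reflection_orthogonal_sphere_apply e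
  have hRi : ∀ (v : EuclideanSpace ℝ (Fin 3)) (i : Fin 3), ((ℝ ∙ (e : EuclideanSpace ℝ (Fin 3)))ᗮ.reflection v) i =
      v i - 2 * v j * (if i = j then 1 else 0) := fun v i => by
    rw [hR, he]
    simp [EuclideanSpace.inner_single_right, PiLp.single_apply]
  refine k2r_ref_integral_sphere_eq_zero_of_isometry ((ℝ ∙ (e : EuclideanSpace ℝ (Fin 3)))ᗮ.reflection)
    fun ω => hF ω _ ?_ ?_
  · rw [MapsTo.val_restrict_apply, hRi, if_pos rfl]
    ring
  · intro i hij
    rw [MapsTo.val_restrict_apply, hRi, if_neg hij]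
    ring

/-- The height `⟪a, ω⟫` composed with a profile continuous on `[-1, 1]` is continuous on `S²`
(unit `a`). [folklore] -/
theorem k2r_ref_continuous_comp_inner {a : EuclideanSpace ℝ (Fin 3)} (ha : ‖a‖ = 1) {g : ℝ → ℝ}
    (hg : ContinuousOn g (Icc (-1) 1)) : Continuous fun ω : sphere (0 : EuclideanSpace ℝ (Fin 3)) 1 => g ⟪a, (ω : EuclideanSpace ℝ (Fin 3))⟫_ℝ := by
  refine hg.comp_continuous (continuous_const.inner continuous_subtype_val) fun ω => ?_
  have h : |⟪a, (ω : EuclideanSpace ℝ (Fin 3))⟫_ℝ| ≤ 1 := by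
    have := abs_real_inner_le_norm a (ω : EuclideanSpace ℝ (Fin 3))
    rwa [ha, norm_eq_of_mem_sphere ω, one_mul] at this
  exact ⟨(abs_le.1 h).1, (abs_le.1 h).2⟩

/-- A profile continuous on `[-1, 1]` of one coordinate is continuous on `S²`. [folklore] -/
theorem k2r_ref_continuous_comp_coord (i : Fin 3) {g : ℝ → ℝ} (hg : ContinuousOn g (Icc (-1) 1)) :
    Continuous fun ω : sphere (0 : EuclideanSpace ℝ (Fin 3)) 1 => g ((ω : EuclideanSpace ℝ (Fin 3)) i) :=
  hg.comp_continuous ((EuclideanSpace.proj i).continuous.comp continuous_subtype_val)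
    fun ω => k2r_ref_coord_mem_Icc ω i

/-! ### The degree-one Funk–Hecke formula -/

/-- **Funk–Hecke in degree one**: for a unit vector `a` of `ℝ³` and `g` continuous on `[-1, 1]`,
`∫_{S²} g(⟪a, ν⟫) ν dσ(ν) = (2π ∫_{-1}^{1} t g(t) dt) a`. The reflection `v ↦ 2⟪a,v⟫a - v` fixes
the height and `σ`, so `I = (∫ 2⟪a,ν⟫ g(⟪a,ν⟫) dσ) a - I`; the scalar is the hat-box law. [folklore] -/
theorem k2r_ref_funkHecke_one (a : EuclideanSpace ℝ (Fin 3)) (ha : ‖a‖ = 1) (g : ℝ → ℝ) (hg : ContinuousOn g (Icc (-1) 1)) :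
    ∫ ν : sphere (0 : EuclideanSpace ℝ (Fin 3)) 1, g (inner ℝ a (ν : EuclideanSpace ℝ (Fin 3))) • (ν : EuclideanSpace ℝ (Fin 3)) ∂sphereMeasure =
      (2 * Real.pi * ∫ t in (-1 : ℝ)..1, t * g t) • a := by
  haveI := isFiniteMeasure_sphereMeasure (E := EuclideanSpace ℝ (Fin 3))
  set aS : sphere (0 : EuclideanSpace ℝ (Fin 3)) 1 := ⟨a, by simp [ha]⟩ with haS
  set A : EuclideanSpace ℝ (Fin 3) ≃ₗᵢ[ℝ] EuclideanSpace ℝ (Fin 3) := (ℝ ∙ a).reflection with hAdef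
  have hA : ∀ v : EuclideanSpace ℝ (Fin 3), A v = (2 * ⟪v, a⟫_ℝ) • a - v := fun v => by
    have h := reflection_orthogonal_sphere_apply aS v
    rw [Submodule.reflection_orthogonal_apply] at h
    have h' : ((aS : sphere (0 : EuclideanSpace ℝ (Fin 3)) 1) : EuclideanSpace ℝ (Fin 3)) = a := rfl
    rw [h'] at h
    rw [hAdef, ← neg_neg ((ℝ ∙ a).reflection v), h]
    abel
  have hinnerA : ∀ v : EuclideanSpace ℝ (Fin 3), ⟪a, A v⟫_ℝ = ⟪a, v⟫_ℝ := fun v => by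
    rw [hA, inner_sub_right, inner_smul_right, real_inner_self_eq_norm_sq, ha, real_inner_comm]
    ring
  set F : sphere (0 : EuclideanSpace ℝ (Fin 3)) 1 → EuclideanSpace ℝ (Fin 3) := fun ν => g ⟪a, (ν : EuclideanSpace ℝ (Fin 3))⟫_ℝ • (ν : EuclideanSpace ℝ (Fin 3)) with hFdef
  have hgc : Continuous fun ω : sphere (0 : EuclideanSpace ℝ (Fin 3)) 1 => g ⟪a, (ω : EuclideanSpace ℝ (Fin 3))⟫_ℝ := k2r_ref_continuous_comp_inner ha hg
  have hFi : Integrable F (sphereMeasure : Measure (sphere (0 : EuclideanSpace ℝ (Fin 3)) 1)) :=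
    integrable_sphere_of_continuous' (hgc.smul continuous_subtype_val)
  have hHi : Integrable (fun ν : sphere (0 : EuclideanSpace ℝ (Fin 3)) 1 => (2 * (⟪a, (ν : EuclideanSpace ℝ (Fin 3))⟫_ℝ * g ⟪a, (ν : EuclideanSpace ℝ (Fin 3))⟫_ℝ)) • a)
      (sphereMeasure : Measure (sphere (0 : EuclideanSpace ℝ (Fin 3)) 1)) :=
    integrable_sphere_of_continuous'
      ((continuous_const.mul ((continuous_const.inner continuous_subtype_val).mul hgc)).smul
        continuous_const)
  have hcomp : ∀ ω : sphere (0 : EuclideanSpace ℝ (Fin 3)) 1, F ((mapsTo_sphere_linearIsometryEquiv A).restrict _ _ _ ω) =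
      (2 * (⟪a, (ω : EuclideanSpace ℝ (Fin 3))⟫_ℝ * g ⟪a, (ω : EuclideanSpace ℝ (Fin 3))⟫_ℝ)) • a - F ω := fun ω => by
    simp only [hFdef, MapsTo.val_restrict_apply]
    rw [hinnerA, hA, smul_sub, smul_smul, real_inner_comm]
    ring_nf
  have key := integral_sphere_comp_isometry A F
  simp_rw [hcomp] at key
  rw [integral_sub hHi hFi, integral_smul_const, sub_eq_iff_eq_add, ← two_smul ℝ,
    integral_const_mul] at key
  have hsc : ∫ ν : sphere (0 : EuclideanSpace ℝ (Fin 3)) 1, ⟪a, (ν : EuclideanSpace ℝ (Fin 3))⟫_ℝ * g ⟪a, (ν : EuclideanSpace ℝ (Fin 3))⟫_ℝ ∂sphereMeasure =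
      2 * π * ∫ t in (-1 : ℝ)..1, t * g t :=
    integral_sphere_comp_inner_real ha (g := fun t => t * g t)
      ((continuousOn_id.mul hg).aestronglyMeasurable measurableSet_Icc)
  change ∫ ν : sphere (0 : EuclideanSpace ℝ (Fin 3)) 1, F ν ∂sphereMeasure = _
  have h2 : (2 : ℝ) • ∫ ν : sphere (0 : EuclideanSpace ℝ (Fin 3)) 1, F ν ∂sphereMeasure = (2 : ℝ) • ((2 * π * ∫ t in (-1 : ℝ)..1, t * g t) • a) := by
    rw [← key, hsc, smul_smul]
  exact smul_right_injective (EuclideanSpace ℝ (Fin 3)) (two_ne_zero' ℝ) h2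

/-! ### Hat-box constants along a coordinate axis -/

/-- Hat-box law along the `i`-th axis: `∫_{S²} g(ν_i) dσ(ν) = 2π ∫_{-1}^{1} g`. [folklore] -/
theorem k2r_ref_integral_sphere_coord (i : Fin 3) {g : ℝ → ℝ}
    (hg : AEStronglyMeasurable g (volume.restrict (Icc (-1 : ℝ) 1))) :
    ∫ ν : sphere (0 : EuclideanSpace ℝ (Fin 3)) 1, g ((ν : EuclideanSpace ℝ (Fin 3)) i) ∂sphereMeasure = 2 * π * ∫ x in (-1 : ℝ)..1, g x := by
  have h := integral_sphere_comp_inner_real (a := EuclideanSpace.single i (1 : ℝ)) (by simp) hg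
  simpa [EuclideanSpace.inner_single_left] using h

/-- Second moment of one coordinate: `∫_{S²} ν_i² dσ = 4π/3`. [folklore] -/
theorem k2r_ref_integral_coord_sq (i : Fin 3) :
    ∫ ν : sphere (0 : EuclideanSpace ℝ (Fin 3)) 1, (ν : EuclideanSpace ℝ (Fin 3)) i ^ 2 ∂sphereMeasure = 4 * π / 3 := by
  have h := integral_sphere_inner_sq (EuclideanSpace.single i (1 : ℝ))
  simpa [EuclideanSpace.inner_single_left] using h

/-- `∫_{-1}^{1} (t₊)ⁿ dt = 1/(n+1)` for `n ≠ 0`. [folklore] -/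
theorem k2r_ref_integral_max_pow {n : ℕ} (hn : n ≠ 0) :
    ∫ t in (-1 : ℝ)..1, max t 0 ^ n = 1 / (n + 1) := by
  have hc : Continuous fun t : ℝ => max t 0 ^ n := by fun_prop
  rw [← intervalIntegral.integral_add_adjacent_intervals (hc.intervalIntegrable (-1) 0)
    (hc.intervalIntegrable 0 1)]
  have e1 : ∫ t in (-1 : ℝ)..0, max t 0 ^ n = ∫ _ in (-1 : ℝ)..0, (0 : ℝ) :=
    intervalIntegral.integral_congr fun t ht => by
      rw [uIcc_of_le (by norm_num)] at ht
      simp [max_eq_right ht.2, zero_pow hn]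
  have e2 : ∫ t in (0 : ℝ)..1, max t 0 ^ n = ∫ t in (0 : ℝ)..1, t ^ n :=
    intervalIntegral.integral_congr fun t ht => by
      rw [uIcc_of_le zero_le_one] at ht
      simp [max_eq_left ht.1]
  rw [e1, e2, intervalIntegral.integral_zero, integral_pow]
  simp

/-- Positive-part moments of one coordinate: `∫_{S²} (ν_i)₊ⁿ dσ = 2π/(n+1)` (`n ≠ 0`);
e.g. `π/2` for `n = 3` and `2π/5` for `n = 4`. [folklore] -/
theorem k2r_ref_integral_coord_pos_pow (i : Fin 3) {n : ℕ} (hn : n ≠ 0) :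
    ∫ ν : sphere (0 : EuclideanSpace ℝ (Fin 3)) 1, max ((ν : EuclideanSpace ℝ (Fin 3)) i) 0 ^ n ∂sphereMeasure = 2 * π / (n + 1) := by
  rw [k2r_ref_integral_sphere_coord i (g := fun t => max t 0 ^ n)
    (Continuous.aestronglyMeasurable (by fun_prop)), k2r_ref_integral_max_pow hn]
  ring

/-! ### Trigonometric moments of one coordinate -/

/-- `(2/π) k t² ≤ t sin(kt) ≤ k t²` for `|t| ≤ 1` and `0 ≤ k ≤ π/2` (Jordan's inequality and
`|sin x| ≤ |x|`). [folklore] -/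
theorem k2r_ref_mul_sin_bounds {k t : ℝ} (hk0 : 0 ≤ k) (hk1 : k ≤ π / 2) (ht : t ∈ Icc (-1 : ℝ) 1) :
    2 / π * k * t ^ 2 ≤ t * Real.sin (k * t) ∧ t * Real.sin (k * t) ≤ k * t ^ 2 := by
  constructor
  · rcases le_or_gt 0 t with h | h
    · have hx1 : k * t ≤ π / 2 := (mul_le_of_le_one_right hk0 ht.2).trans hk1
      have hs := Real.mul_le_sin (mul_nonneg hk0 h) hx1
      calc 2 / π * k * t ^ 2 = t * (2 / π * (k * t)) := by ring
        _ ≤ t * Real.sin (k * t) := mul_le_mul_of_nonneg_left hs h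
    · have hx1 : k * (-t) ≤ π / 2 := (mul_le_of_le_one_right hk0 (by linarith [ht.1])).trans hk1
      have hs := Real.mul_le_sin (mul_nonneg hk0 (by linarith : 0 ≤ -t)) hx1
      rw [mul_neg, Real.sin_neg] at hs
      have h3 := mul_le_mul_of_nonneg_left (by linarith : Real.sin (k * t) ≤ 2 / π * (k * t))
        (by linarith : 0 ≤ -t)
      calc 2 / π * k * t ^ 2 = -(-t * (2 / π * (k * t))) := by ring
        _ ≤ -(-t * Real.sin (k * t)) := neg_le_neg h3
        _ = t * Real.sin (k * t) := by ring
  · calc t * Real.sin (k * t) ≤ |t * Real.sin (k * t)| := le_abs_self _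
      _ = |t| * |Real.sin (k * t)| := abs_mul _ _
      _ ≤ |t| * |k * t| := mul_le_mul_of_nonneg_left Real.abs_sin_le_abs (abs_nonneg _)
      _ = k * t ^ 2 := by rw [abs_mul, abs_of_nonneg hk0, ← sq_abs t]; ring

/-- `(2/π²) k² t² ≤ 1 - cos(kt) ≤ k² t²/2` for `|t| ≤ 1` and `0 ≤ k ≤ π/2`. [folklore] -/
theorem k2r_ref_one_sub_cos_bounds {k t : ℝ} (hk0 : 0 ≤ k) (hk1 : k ≤ π / 2)
    (ht : t ∈ Icc (-1 : ℝ) 1) :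
    2 / π ^ 2 * k ^ 2 * t ^ 2 ≤ 1 - Real.cos (k * t) ∧
      1 - Real.cos (k * t) ≤ k ^ 2 / 2 * t ^ 2 := by
  constructor
  · have habs : |k * t| ≤ π := by
      rw [abs_mul, abs_of_nonneg hk0]
      calc k * |t| ≤ k * 1 := mul_le_mul_of_nonneg_left (abs_le.2 ht) hk0
        _ ≤ π := by linarith [Real.pi_pos]
    have hc := Real.cos_le_one_sub_mul_cos_sq habs
    calc 2 / π ^ 2 * k ^ 2 * t ^ 2 = 2 / π ^ 2 * (k * t) ^ 2 := by ring
      _ ≤ 1 - Real.cos (k * t) := by linarith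
  · have hc := Real.one_sub_sq_div_two_le_cos (x := k * t)
    calc 1 - Real.cos (k * t) ≤ (k * t) ^ 2 / 2 := by linarith
      _ = k ^ 2 / 2 * t ^ 2 := by ring

/-- Odd trigonometric moments vanish: `∫ sin(k ν_i) dσ = 0`, `∫ ν_i (cos(k ν_i) - 1) dσ = 0`.
[folklore] -/
theorem k2r_ref_sphere_odd_vanish (i : Fin 3) (k : ℝ) :
    (∫ ν : sphere (0 : EuclideanSpace ℝ (Fin 3)) 1, Real.sin (k * (ν : EuclideanSpace ℝ (Fin 3)) i) ∂sphereMeasure) = 0 ∧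
    (∫ ν : sphere (0 : EuclideanSpace ℝ (Fin 3)) 1, (ν : EuclideanSpace ℝ (Fin 3)) i * (Real.cos (k * (ν : EuclideanSpace ℝ (Fin 3)) i) - 1) ∂sphereMeasure) = 0 := by
  refine ⟨k2r_ref_integral_sphere_eq_zero_of_flip i fun ω ω' h _ => ?_,
    k2r_ref_integral_sphere_eq_zero_of_flip i fun ω ω' h _ => ?_⟩
  · rw [h, mul_neg, Real.sin_neg]
  · rw [h, mul_neg, Real.cos_neg, neg_mul]

/-- Transverse moments vanish: `∫ ν_j g(ν_i) dσ = 0`, `∫ ν_i ν_j g(ν_i) dσ = 0` for `j ≠ i`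
(flip the `j`-th coordinate). [folklore] -/
theorem k2r_ref_sphere_transverse_vanish {i j : Fin 3} (hj : j ≠ i) (g : ℝ → ℝ) :
    (∫ ν : sphere (0 : EuclideanSpace ℝ (Fin 3)) 1, (ν : EuclideanSpace ℝ (Fin 3)) j * g ((ν : EuclideanSpace ℝ (Fin 3)) i) ∂sphereMeasure) = 0 ∧
    (∫ ν : sphere (0 : EuclideanSpace ℝ (Fin 3)) 1, (ν : EuclideanSpace ℝ (Fin 3)) i * (ν : EuclideanSpace ℝ (Fin 3)) j * g ((ν : EuclideanSpace ℝ (Fin 3)) i) ∂sphereMeasure) = 0 := by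
  refine ⟨k2r_ref_integral_sphere_eq_zero_of_flip j fun ω ω' h h' => ?_,
    k2r_ref_integral_sphere_eq_zero_of_flip j fun ω ω' h h' => ?_⟩
  · rw [h, h' i hj.symm, neg_mul]
  · rw [h, h' i hj.symm, mul_neg, neg_mul]

/-- **Trigonometric delocalisation constants.** For `0 ≤ k ≤ π/2`:
`8k/3 ≤ ∫ ν_i sin(kν_i) dσ ≤ 4πk/3`, `k²/2 ≤ ∫ (1 - cos(kν_i)) dσ ≤ 2πk²/3`,
`0 ≤ ∫ ν_i²(1 - cos(kν_i)) dσ ≤ 2πk²/3` (pointwise Jordan-type bounds against `∫ ν_i² dσ = 4π/3`).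
[folklore] -/
theorem k2r_ref_sphere_trig (i : Fin 3) {k : ℝ} (hk0 : 0 ≤ k) (hk1 : k ≤ π / 2) :
    8 * k / 3 ≤ (∫ ν : sphere (0 : EuclideanSpace ℝ (Fin 3)) 1, (ν : EuclideanSpace ℝ (Fin 3)) i * Real.sin (k * (ν : EuclideanSpace ℝ (Fin 3)) i) ∂sphereMeasure) ∧
    (∫ ν : sphere (0 : EuclideanSpace ℝ (Fin 3)) 1, (ν : EuclideanSpace ℝ (Fin 3)) i * Real.sin (k * (ν : EuclideanSpace ℝ (Fin 3)) i) ∂sphereMeasure) ≤ 4 * π * k / 3 ∧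
    k ^ 2 / 2 ≤ (∫ ν : sphere (0 : EuclideanSpace ℝ (Fin 3)) 1, (1 - Real.cos (k * (ν : EuclideanSpace ℝ (Fin 3)) i)) ∂sphereMeasure) ∧
    (∫ ν : sphere (0 : EuclideanSpace ℝ (Fin 3)) 1, (1 - Real.cos (k * (ν : EuclideanSpace ℝ (Fin 3)) i)) ∂sphereMeasure) ≤ 2 * π * k ^ 2 / 3 ∧
    0 ≤ (∫ ν : sphere (0 : EuclideanSpace ℝ (Fin 3)) 1, (ν : EuclideanSpace ℝ (Fin 3)) i ^ 2 * (1 - Real.cos (k * (ν : EuclideanSpace ℝ (Fin 3)) i)) ∂sphereMeasure) ∧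
    (∫ ν : sphere (0 : EuclideanSpace ℝ (Fin 3)) 1, (ν : EuclideanSpace ℝ (Fin 3)) i ^ 2 * (1 - Real.cos (k * (ν : EuclideanSpace ℝ (Fin 3)) i)) ∂sphereMeasure)
      ≤ 2 * π * k ^ 2 / 3 := by
  haveI := isFiniteMeasure_sphereMeasure (E := EuclideanSpace ℝ (Fin 3))
  have hc : Continuous fun ν : sphere (0 : EuclideanSpace ℝ (Fin 3)) 1 => (ν : EuclideanSpace ℝ (Fin 3)) i :=
    (EuclideanSpace.proj i).continuous.comp continuous_subtype_val
  have hcos : Continuous fun ν : sphere (0 : EuclideanSpace ℝ (Fin 3)) 1 => 1 - Real.cos (k * (ν : EuclideanSpace ℝ (Fin 3)) i) :=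
    continuous_const.sub (Real.continuous_cos.comp (continuous_const.mul hc))
  have hsq : ∀ c : ℝ, ∫ ν : sphere (0 : EuclideanSpace ℝ (Fin 3)) 1, c * (ν : EuclideanSpace ℝ (Fin 3)) i ^ 2 ∂sphereMeasure = c * (4 * π / 3) := fun c => by
    rw [integral_const_mul, k2r_ref_integral_coord_sq]
  have hI : ∀ c : ℝ, Integrable (fun ν : sphere (0 : EuclideanSpace ℝ (Fin 3)) 1 => c * (ν : EuclideanSpace ℝ (Fin 3)) i ^ 2) sphereMeasure := fun c =>
    integrable_sphere_of_continuous' (continuous_const.mul (hc.pow 2))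
  have hI1 : Integrable (fun ν : sphere (0 : EuclideanSpace ℝ (Fin 3)) 1 => (ν : EuclideanSpace ℝ (Fin 3)) i * Real.sin (k * (ν : EuclideanSpace ℝ (Fin 3)) i)) sphereMeasure :=
    integrable_sphere_of_continuous' (hc.mul (Real.continuous_sin.comp (continuous_const.mul hc)))
  have hI2 : Integrable (fun ν : sphere (0 : EuclideanSpace ℝ (Fin 3)) 1 => 1 - Real.cos (k * (ν : EuclideanSpace ℝ (Fin 3)) i)) sphereMeasure :=
    integrable_sphere_of_continuous' hcos
  have hI3 : Integrable (fun ν : sphere (0 : EuclideanSpace ℝ (Fin 3)) 1 => (ν : EuclideanSpace ℝ (Fin 3)) i ^ 2 * (1 - Real.cos (k * (ν : EuclideanSpace ℝ (Fin 3)) i)))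
      sphereMeasure := integrable_sphere_of_continuous' ((hc.pow 2).mul hcos)
  refine ⟨?_, ?_, ?_, ?_, ?_, ?_⟩
  · calc 8 * k / 3 = 2 / π * k * (4 * π / 3) := by field_simp; ring
      _ = ∫ ν : sphere (0 : EuclideanSpace ℝ (Fin 3)) 1, 2 / π * k * (ν : EuclideanSpace ℝ (Fin 3)) i ^ 2 ∂sphereMeasure := (hsq _).symm
      _ ≤ _ := integral_mono (hI _) hI1 fun ν =>
          (k2r_ref_mul_sin_bounds hk0 hk1 (k2r_ref_coord_mem_Icc ν i)).1
  · calc _ ≤ ∫ ν : sphere (0 : EuclideanSpace ℝ (Fin 3)) 1, k * (ν : EuclideanSpace ℝ (Fin 3)) i ^ 2 ∂sphereMeasure := integral_mono hI1 (hI _) fun ν =>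
          (k2r_ref_mul_sin_bounds hk0 hk1 (k2r_ref_coord_mem_Icc ν i)).2
      _ = 4 * π * k / 3 := by rw [hsq]; ring
  · calc k ^ 2 / 2 ≤ 2 / π ^ 2 * k ^ 2 * (4 * π / 3) := by
          rw [show 2 / π ^ 2 * k ^ 2 * (4 * π / 3) = k ^ 2 * (8 / (3 * π)) by field_simp; ring]
          have hπ : 1 / 2 ≤ 8 / (3 * π) := by
            rw [div_le_div_iff₀ (by norm_num) (by positivity)]; nlinarith [Real.pi_le_four]
          nlinarith [sq_nonneg k]
      _ = ∫ ν : sphere (0 : EuclideanSpace ℝ (Fin 3)) 1, 2 / π ^ 2 * k ^ 2 * (ν : EuclideanSpace ℝ (Fin 3)) i ^ 2 ∂sphereMeasure := (hsq _).symm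
      _ ≤ _ := integral_mono (hI _) hI2 fun ν =>
          (k2r_ref_one_sub_cos_bounds hk0 hk1 (k2r_ref_coord_mem_Icc ν i)).1
  · calc _ ≤ ∫ ν : sphere (0 : EuclideanSpace ℝ (Fin 3)) 1, k ^ 2 / 2 * (ν : EuclideanSpace ℝ (Fin 3)) i ^ 2 ∂sphereMeasure := integral_mono hI2 (hI _) fun ν =>
          (k2r_ref_one_sub_cos_bounds hk0 hk1 (k2r_ref_coord_mem_Icc ν i)).2
      _ = 2 * π * k ^ 2 / 3 := by rw [hsq]; ring
  · exact integral_nonneg fun ν => mul_nonneg (sq_nonneg _) (sub_nonneg.2 (Real.cos_le_one _))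
  · calc _ ≤ ∫ ν : sphere (0 : EuclideanSpace ℝ (Fin 3)) 1, k ^ 2 / 2 * (ν : EuclideanSpace ℝ (Fin 3)) i ^ 2 ∂sphereMeasure := by
          refine integral_mono hI3 (hI _) fun ν => ?_
          have ht := k2r_ref_coord_mem_Icc ν i
          have ht2 : (ν : EuclideanSpace ℝ (Fin 3)) i ^ 2 ≤ 1 := by nlinarith [ht.1, ht.2]
          have h0 : 0 ≤ 1 - Real.cos (k * (ν : EuclideanSpace ℝ (Fin 3)) i) := sub_nonneg.2 (Real.cos_le_one _)
          calc (ν : EuclideanSpace ℝ (Fin 3)) i ^ 2 * (1 - Real.cos (k * (ν : EuclideanSpace ℝ (Fin 3)) i))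
              ≤ 1 * (1 - Real.cos (k * (ν : EuclideanSpace ℝ (Fin 3)) i)) := mul_le_mul_of_nonneg_right ht2 h0
            _ ≤ k ^ 2 / 2 * (ν : EuclideanSpace ℝ (Fin 3)) i ^ 2 := by
                rw [one_mul]; exact (k2r_ref_one_sub_cos_bounds hk0 hk1 ht).2
      _ = 2 * π * k ^ 2 / 3 := by rw [hsq]; ring

/-! ### Polar coordinates in `ℝ³` -/

/-- Radial integration in `ℝ³`: `∫ f(|v|) dv = 4π ∫₀^∞ r² f(r) dr` (`3 · vol(B₁) = 4π`; both
sides are junk together). [folklore] -/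
theorem k2r_ref_integral_radial (f : ℝ → ℝ) :
    ∫ v : EuclideanSpace ℝ (Fin 3), f ‖v‖ = 4 * π * ∫ r in Ioi (0 : ℝ), r ^ 2 * f r := by
  rw [integral_fun_norm_addHaar volume f, finrank_euclideanSpace_fin, Measure.real,
    EuclideanSpace.volume_ball_fin_three, ENNReal.toReal_mul, ENNReal.ofReal_one, one_pow,
    ENNReal.toReal_one, ENNReal.toReal_ofReal (by positivity)]
  simp only [nsmul_eq_mul, smul_eq_mul]
  norm_num
  ring

/-- Integrability transfer for radial functions on `ℝ³`:
`f(|·|) ∈ L¹(ℝ³) ↔ r² f(r) ∈ L¹(0, ∞)`. [folklore] -/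
theorem k2r_ref_integrable_radial_iff (f : ℝ → ℝ) :
    Integrable (fun v : EuclideanSpace ℝ (Fin 3) => f ‖v‖) ↔ IntegrableOn (fun r => r ^ 2 * f r) (Ioi (0 : ℝ)) := by
  have h := integrable_fun_norm_addHaar (volume : Measure (EuclideanSpace ℝ (Fin 3))) (f := f)
  rw [finrank_euclideanSpace_fin] at h
  simpa using h

/-- Integrability on `ℝ³` by radial domination: `|f(v)| ≤ F(|v|)` with `r² F(r) ∈ L¹(0, ∞)` and
`f` continuous. [folklore] -/
theorem k2r_ref_integrable_of_norm_le {f : EuclideanSpace ℝ (Fin 3) → ℝ} (hf : Continuous f) (F : ℝ → ℝ)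
    (hF : IntegrableOn (fun r => r ^ 2 * F r) (Ioi (0 : ℝ))) (h : ∀ v, |f v| ≤ F ‖v‖) :
    Integrable f :=
  ((k2r_ref_integrable_radial_iff F).2 hF).mono' hf.aestronglyMeasurable
    (Eventually.of_forall fun v => by rw [Real.norm_eq_abs]; exact h v)

/-- **Separated polar formula**: if `f ∈ L¹(ℝ³)` factorises along rays, `f(rω) = φ(r) Y(ω)`
(`r > 0`, `ω ∈ S²`), then `∫ f = (∫_{S²} Y dσ) · ∫₀^∞ r² φ(r) dr`. [folklore] -/
theorem k2r_ref_integral_polar {f : EuclideanSpace ℝ (Fin 3) → ℝ} (hf : Integrable f) (φ : ℝ → ℝ) (Y : sphere (0 : EuclideanSpace ℝ (Fin 3)) 1 → ℝ)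
    (h : ∀ r : ℝ, 0 < r → ∀ ω : sphere (0 : EuclideanSpace ℝ (Fin 3)) 1, f (r • (ω : EuclideanSpace ℝ (Fin 3))) = φ r * Y ω) :
    ∫ v, f v = (∫ ω, Y ω ∂(sphereMeasure : Measure (sphere (0 : EuclideanSpace ℝ (Fin 3)) 1))) * ∫ r in Ioi (0 : ℝ), r ^ 2 * φ r := by
  rw [integral_eq_integral_Ioi_sphereIntegral volume hf, finrank_euclideanSpace_fin,
    ← integral_const_mul]
  refine setIntegral_congr_fun measurableSet_Ioi fun r hr => ?_
  simp only [sphereIntegral_def, smul_eq_mul]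
  simp_rw [h r hr]
  rw [integral_const_mul]
  change r ^ (3 - 1) * (φ r * ∫ ω, Y ω ∂(sphereMeasure : Measure (sphere (0 : EuclideanSpace ℝ (Fin 3)) 1))) = _
  norm_num
  ring

/-! ### Registered sub-goal -/

/-- **Registered sub-goal `stub_sphereCalculus_prep`** (keyed theorem of this preparatory file):
the degree-one Funk–Hecke formula `∫_{S²} g(⟪a, ν⟫) ν dσ(ν) = (2π ∫_{-1}^{1} t g(t) dt) a` for a
unit vector `a` of `ℝ³` and `g` continuous on `[-1, 1]` (`k2r_ref_funkHecke_one`). [folklore] -/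
theorem stub_sphereCalculus_prep : ∀ (a : EuclideanSpace ℝ (Fin 3)), ‖a‖ = 1 → ∀ g : ℝ → ℝ, ContinuousOn g (Set.Icc (-1) 1) → (∫ ν : Metric.sphere (0 : EuclideanSpace ℝ (Fin 3)) 1, g (inner ℝ a (ν : EuclideanSpace ℝ (Fin 3))) • (ν : EuclideanSpace ℝ (Fin 3)) ∂Literature.MathematicalPhysics.KineticTheory.sphereMeasure) = (2 * Real.pi * ∫ t in (-1 : ℝ)..1, t * g t) • a :=
  k2r_ref_funkHecke_one

end Summit.AtomisticToContinuum.HydrodynamicLimit.Theorems.EnskogAdjointDuality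

end
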